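import Summits.Ventures.PercRepro.Night2TwoOneTypes

/-!
# PercRepro — the cell `(2, 1)`: a lossy big member is a line plus two points; no load at the top levels
(night-2, gen 27)

Groundwork for the `(2, 1)` nested residue, continued.  A big thin member `B′` (`|B′ ∖ K| ≥ 5`) loses at its covering
set `Q′ = B′ ∪ {z}` only if `L1 (Q′) > capS (Q′) ≥ 11/18`, hence only if `Q′` has at least three thin covering preimages
(each requests `≤ 7/24`); those are faces `Q′ ∖ w` at coloops `w` of `Q′ ∖ K`, so two of them, `w, w′`, lie in `B′ ∖ K`
and `(B′ ∖ K) ∖ {w, w′}` has rank `5 − 2 − 1 = 2` (`z` is a coloop as well): **`B′` is bad** — a rank-`2` set plus two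
points.  A target receiving distance-one load therefore has `|S ∖ K| = |B′ ∖ K| + 2 ≤ (the longest line) + 4`: when
no line of `V` carries `n − 7` points, the top three levels (`|S ∖ K| ≥ n − 3`) carry no load at all.

* `rkN_sdiff_coloops_eq_five_two`: the off-coloop part of a shadow set of the cell has rank `5`;
* **`bad_of_loss_ne_zero_two_one`**: a lossy member (big or not) is a rank-`2` set plus two points;
* **`dload_missed_eq_zero_of_top_two_one`**: no distance-one load at `|S ∖ K| ≥ n − 3` when every line of `V` has
  at most `n − 8` points.
-/

namespace PercRepro.Shadow

open Finset PerFlat ThmH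

variable {α : Type*} [DecidableEq α] {M : Matroid α} [M.Finite]

section TwoOneSources

variable {G : Finset α}

open scoped Classical in
/-- The off-coloop part of a shadow set of the cell `(2, 1)` has rank `5`. -/
theorem rkN_sdiff_coloops_eq_five_two (hG : G ∈ flatsQ M (5 + 1)) (hk : kColoops M G = 1) {S : Finset α}
    (hS : S ∈ shadowAt M (5 + 2) 5 (Uq M (5 + 2) 5) G) : rkN M (S \ coloops M G) = 5 := by
  have hGg : G ⊆ gr M := (mem_flatsQ.1 hG).1
  have hSG : S ⊆ G := subset_G_of_mem_shadowAt hS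
  have hKS : coloops M G ⊆ S := coloops_subset_of_mem_shadowAt hS
  have h6 : rkN M S = 6 := by
    have hclS : clF M S = G := (mem_shadowAt.1 hS).2
    have := rkN_clF (M := M) S
    rw [hclS] at this
    have hG6 : M.eRk (G : Set α) = ((5 + 1 : ℕ) : ℕ∞) := (mem_flatsQ.1 hG).2.2
    rw [eRk_eq_rkN] at hG6
    have : rkN M G = 6 := by exact_mod_cast hG6
    omega
  have h := eRk_eq_kColoops_add_sdiff hGg hSG hKS
  rw [eRk_eq_rkN, eRk_eq_rkN, hk, h6] at h
  have h' : ((6 : ℕ) : ℕ∞) = ((1 + rkN M (S \ coloops M G) : ℕ) : ℕ∞) := by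
    rw [Nat.cast_add]; exact_mod_cast h
  have h'' : 6 = 1 + rkN M (S \ coloops M G) := by exact_mod_cast h'
  omega

open scoped Classical in
/-- **A LOSSY MEMBER OF THE CELL `(2, 1)` IS A RANK-`2` SET PLUS TWO POINTS**: if `B′` is a thin member and
`z ∈ G ∖ cl B′` with `loss B′ z ≠ 0`, then `B′` is bad (big or not). -/
theorem bad_of_loss_ne_zero_two_one (hG : G ∈ flatsQ M (5 + 1)) (hd : (gr M \ G).card = 2) (hk : kColoops M G = 1)
    {B : Finset α} (hB : B ∈ thinMembers M 5 G) {z : α} (hz : z ∈ G \ clF M B)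
    (hl : loss M 5 G B z ≠ 0) : BadTarget M G B := by
  have hd' : (gr M \ G).card ≤ 5 := by omega
  have hGg : G ⊆ gr M := (mem_flatsQ.1 hG).1
  have hB' : B ∈ membersIn M (Uq M (5 + 2) 5) G := (mem_thinMembers.1 hB).1
  have hBU : B ∈ Uq M (5 + 2) 5 := (mem_membersIn.1 hB').1
  have hBG : B ⊆ G := (subset_clF hBU).trans (mem_membersIn.1 hB').2
  have hKB : coloops M G ⊆ B := coloops_subset_of_mem_thinMembers hG hd' hB
  have hzB : z ∉ B := notMem_of_notMem_clF hBU (Finset.mem_sdiff.1 hz).2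
  have hzK : z ∉ coloops M G := fun h => hzB (hKB h)
  set Q := insert z B with hQ
  have hQsh : Q ∈ shadowAt M (5 + 2) 5 (Uq M (5 + 2) 5) G := insert_mem_shadowAt_thin hG hB hz
  have hQG : Q ⊆ G := subset_G_of_mem_shadowAt hQsh
  have hQK : Q \ coloops M G = insert z (B \ coloops M G) := by
    rw [hQ, Finset.insert_sdiff_of_notMem _ hzK]
  -- the covering set is saturated: `L1 Q > capS Q ≥ 11/18`
  have hsat : capS M 5 G Q < L1 M 5 G Q := by
    by_contra h
    push Not at h
    apply hl
    unfold loss fS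
    rw [if_pos h]
    ring
  have hcap := capS_ge_eleven_eighteenths_two_one hd hk hQG
  -- hence at least three thin covering preimages
  set Pre := (coverPreimages M (Uq M (5 + 2) 5) G Q).filter (fun B => B ∉ lay0 M 5 G) with hPre
  have hthin : ∀ B' ∈ Pre, B' ∈ thinMembers M 5 G := by
    intro B' hB'
    rw [hPre, Finset.mem_filter, mem_coverPreimages] at hB'
    exact mem_thinMembers.2 ⟨hB'.1.1, hB'.2⟩
  have hL1 : L1 M 5 G Q ≤ (Pre.card : ℚ) * (7 / 24) := by
    unfold L1
    calc ∑ B' ∈ Pre, req M 5 B' ≤ ∑ _B' ∈ Pre, (7 / 24 : ℚ) :=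
          Finset.sum_le_sum (fun B' hB' => req_le_of_thin_two_one hG hd (hthin B' hB'))
      _ = (Pre.card : ℚ) * (7 / 24) := by rw [Finset.sum_const, nsmul_eq_mul]
  have hPre3 : 3 ≤ Pre.card := by
    by_contra hlt
    push Not at hlt
    have : (Pre.card : ℚ) ≤ 2 := by exact_mod_cast (by omega : Pre.card ≤ 2)
    linarith
  -- the thin preimages are faces at coloops of `Q ∖ K`; three coloops, two of them in `B ∖ K`
  have hsub := thin_coverPreimages_subset_image_coloops hG hd' Q
  have hC3 : 3 ≤ (coloops M (Q \ coloops M G)).card :=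
    hPre3.trans ((Finset.card_le_card hsub).trans Finset.card_image_le)
  have hYg : Q \ coloops M G ⊆ gr M := Finset.sdiff_subset.trans (hQG.trans hGg)
  have hY5 : rkN M (Q \ coloops M G) = 5 := rkN_sdiff_coloops_eq_five_two hG hk hQsh
  have hCY : coloops M (Q \ coloops M G) ⊆ Q \ coloops M G := fun w hw => (mem_coloops.1 hw).1
  have hex : ∃ w ∈ coloops M (Q \ coloops M G), ∃ w' ∈ coloops M (Q \ coloops M G),
      w ≠ w' ∧ w ≠ z ∧ w' ≠ z := by
    have h2 : 2 ≤ ((coloops M (Q \ coloops M G)).erase z).card := by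
      have := Finset.pred_card_le_card_erase (s := coloops M (Q \ coloops M G)) (a := z)
      omega
    obtain ⟨w, hw, w', hw', hne⟩ :=
      Finset.one_lt_card.1 (by omega : 1 < ((coloops M (Q \ coloops M G)).erase z).card)
    rw [Finset.mem_erase] at hw hw'
    exact ⟨w, hw.2, w', hw'.2, hne, hw.1, hw'.1⟩
  obtain ⟨w, hw, w', hw', hww', hwz, hw'z⟩ := hex
  have hwY : w ∈ Q \ coloops M G := hCY hw
  have hw'Y : w' ∈ Q \ coloops M G := hCY hw'
  -- `rk ((Q ∖ K) ∖ {w, w′}) = 3`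
  have h1 : rkN M (Q \ coloops M G) = rkN M ((Q \ coloops M G).erase w) + 1 := rkN_erase_of_mem_coloops hYg hw
  have hw'c : w' ∈ coloops M ((Q \ coloops M G).erase w) := by
    rw [mem_coloops]
    refine ⟨Finset.mem_erase.2 ⟨hww'.symm, hw'Y⟩, fun h => (mem_coloops.1 hw').2 ?_⟩
    exact clF_mono (Finset.erase_subset_erase w' (Finset.erase_subset w _)) h
  have h2 : rkN M ((Q \ coloops M G).erase w) = rkN M (((Q \ coloops M G).erase w).erase w') + 1 :=
    rkN_erase_of_mem_coloops ((Finset.erase_subset w _).trans hYg) hw'c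
  -- `z` is still outside the closure of `R = (B ∖ K) ∖ {w, w′}`, so `R` has rank `2`
  have hRz : ((Q \ coloops M G).erase w).erase w' = insert z ((B \ coloops M G) \ {w, w'}) := by
    rw [hQK]
    ext a
    simp only [Finset.mem_erase, Finset.mem_insert, Finset.mem_sdiff, Finset.mem_singleton, not_or]
    constructor
    · rintro ⟨haw', haw, ha | ha⟩
      · exact Or.inl ha
      · exact Or.inr ⟨ha, haw, haw'⟩
    · rintro (rfl | ⟨ha, haw, haw'⟩)
      · exact ⟨hw'z.symm, hwz.symm, Or.inl rfl⟩
      · exact ⟨haw', haw, Or.inr ha⟩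
  have hzR : z ∉ clF M ((B \ coloops M G) \ {w, w'}) := by
    intro h
    apply (Finset.mem_sdiff.1 hz).2
    exact clF_mono (Finset.sdiff_subset.trans Finset.sdiff_subset) h
  have h3 : rkN M (insert z ((B \ coloops M G) \ {w, w'})) = rkN M ((B \ coloops M G) \ {w, w'}) + 1 :=
    rkN_insert_of_notMem_clF (hGg (Finset.mem_sdiff.1 hz).1) hzR
  rw [hRz] at h2
  have hwB : w ∈ B \ coloops M G := by
    have h := hwY
    rw [hQK, Finset.mem_insert] at h
    rcases h with h | h
    · exact absurd h hwz
    · exact h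
  have hw'B : w' ∈ B \ coloops M G := by
    have h := hw'Y
    rw [hQK, Finset.mem_insert] at h
    rcases h with h | h
    · exact absurd h hw'z
    · exact h
  have hR2 : rkN M ((B \ coloops M G) \ {w, w'}) ≤ 2 := by omega
  exact ⟨w, hwB, w', hw'B, hww', hR2⟩

open scoped Classical in
/-- **NO DISTANCE-ONE LOAD AT THE TOP THREE LEVELS** (cell `(2, 1)`, `P` = the big members) when every line of `V`
has at most `n − 8` points: a source of `S` is a lossy big member `B′ = K ∪ R ∪ {w, w′}` with `R` on a line, so
`|S ∖ K| = |R| + 4 ≤ n − 4`. -/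
theorem dload_missed_eq_zero_of_top_two_one (hG : G ∈ flatsQ M (5 + 1)) (hd : (gr M \ G).card = 2)
    (hk : kColoops M G = 1) (hs : ∀ e ∈ gr M, ∀ f ∈ gr M, e ≠ f → rkN M {e, f} = 2)
    (hline : ∀ p ∈ G \ coloops M G, ∀ p' ∈ G \ coloops M G, p ≠ p' →
      (clF M {p, p'} ∩ (G \ coloops M G)).card + 8 ≤ (G \ coloops M G).card)
    {S : Finset α} (hSG : S ⊆ G) (htop : (G \ coloops M G).card ≤ (S \ coloops M G).card + 3) :
    dload M 5 G (fun B => 5 ≤ (B \ coloops M G).card) (dshMissed M 5 G) S = 0 := by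
  have hd' : (gr M \ G).card ≤ 5 := by omega
  have hGg : G ⊆ gr M := (mem_flatsQ.1 hG).1
  set P : Finset α → Prop := fun B => 5 ≤ (B \ coloops M G).card with hPdef
  have hle := dload_missed_le_sum_sources (P := P) hG hd' S
  have h0 : 0 ≤ dload M 5 G P (dshMissed M 5 G) S :=
    dload_nonneg (fun B z S => dshMissed_nonneg hG hd' B z S) S
  -- every source has a zero loss at every pair
  have hzero : ∀ B ∈ missedSources M 5 G P S, ∀ z ∈ S \ B, loss M 5 G B z = 0 := by
    intro B hB z hz
    by_contra hl
    obtain ⟨⟨hthin, hPB⟩, hBS, hcard, hmiss⟩ := mem_missedSources.1 hB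
    have h5 : 5 ≤ (B \ coloops M G).card := hPB
    have hzc : z ∈ G \ clF M B := hmiss hz
    have hbad := bad_of_loss_ne_zero_two_one hG hd hk hthin hzc hl
    obtain ⟨w, hw, w', hw', hne, hr⟩ := hbad
    have hKB : coloops M G ⊆ B := coloops_subset_of_mem_thinMembers hG hd' hthin
    have hBG : B ⊆ G := hBS.trans hSG
    set R := (B \ coloops M G) \ {w, w'} with hR
    have hRV : R ⊆ G \ coloops M G := Finset.sdiff_subset.trans (Finset.sdiff_subset_sdiff hBG (Finset.Subset.refl _))
    have hRg : R ⊆ gr M := hRV.trans (Finset.sdiff_subset.trans hGg)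
    -- `|R| = |B ∖ K| − 2 ≥ 3`, so `R` has two points `r, r′` and lies on their line
    have hRcard : R.card + 2 = (B \ coloops M G).card := by
      have hpair : ({w, w'} : Finset α) ⊆ B \ coloops M G := by
        intro a ha
        rw [Finset.mem_insert, Finset.mem_singleton] at ha
        rcases ha with rfl | rfl
        · exact hw
        · exact hw'
      rw [hR, Finset.card_sdiff_of_subset hpair, Finset.card_pair hne]
      have := Finset.card_le_card hpair
      rw [Finset.card_pair hne] at this
      omega
    obtain ⟨r, hr', r', hr'', hrr'⟩ := Finset.one_lt_card.1 (by omega : 1 < R.card)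
    have hRsub : R ⊆ clF M (R ∩ {r, r'}) := by
      apply subset_clF_inter_of_rkN_le_two hs hRg hr
      have : ({r, r'} : Finset α) ⊆ R := by
        intro a ha
        rw [Finset.mem_insert, Finset.mem_singleton] at ha
        rcases ha with rfl | rfl
        · exact hr'
        · exact hr''
      rw [Finset.inter_eq_right.2 this, Finset.card_pair hrr']
    have hinter : R ∩ {r, r'} = {r, r'} := by
      apply Finset.inter_eq_right.2
      intro a ha
      rw [Finset.mem_insert, Finset.mem_singleton] at ha
      rcases ha with rfl | rfl
      · exact hr'
      · exact hr''
    rw [hinter] at hRsub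
    have hRline : R ⊆ clF M {r, r'} ∩ (G \ coloops M G) := fun a ha => Finset.mem_inter.2 ⟨hRsub ha, hRV ha⟩
    have hl8 := hline r (hRV hr') r' (hRV hr'') hrr'
    have hRc := Finset.card_le_card hRline
    -- `|S ∖ K| = |B ∖ K| + 2`
    have hSB : (S \ coloops M G).card = (B \ coloops M G).card + 2 := by
      have hKS : coloops M G ⊆ S := hKB.trans hBS
      have h1 : S \ coloops M G = (B \ coloops M G) ∪ (S \ B) := by
        ext a
        simp only [Finset.mem_sdiff, Finset.mem_union]
        constructor
        · rintro ⟨haS, haK⟩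
          by_cases haB : a ∈ B
          · exact Or.inl ⟨haB, haK⟩
          · exact Or.inr ⟨haS, haB⟩
        · rintro (⟨haB, haK⟩ | ⟨haS, haB⟩)
          · exact ⟨hBS haB, haK⟩
          · exact ⟨haS, fun haK => haB (hKB haK)⟩
      have hdisj : Disjoint (B \ coloops M G) (S \ B) := by
        rw [Finset.disjoint_left]; intro a ha hb
        exact (Finset.mem_sdiff.1 hb).2 (Finset.mem_sdiff.1 ha).1
      rw [h1, Finset.card_union_of_disjoint hdisj, hcard]
    omega
  have hsum : ∑ B ∈ missedSources M 5 G P S, ∑ z ∈ S \ B,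
      loss M 5 G B z / (((G \ clF M B).card : ℚ) - 1) = 0 := by
    apply Finset.sum_eq_zero
    intro B hB
    apply Finset.sum_eq_zero
    intro z hz
    rw [hzero B hB z hz, zero_div]
  linarith

end TwoOneSources

end PercRepro.Shadow
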